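import Summits.AtomisticToContinuum.HydrodynamicLimit.Theorems.RelayRaceLocalityNearConstantShortTimeHLAssemblyTheta
import Summits.AtomisticToContinuum.HydrodynamicLimit.Theorems.RelayRaceLocalityNearConstantShortTimeHLFluxRemainder
import Summits.AtomisticToContinuum.HydrodynamicLimit.Theorems.RelayRaceLocalityNearConstantShortTimeHLKineticMoments
import Summits.AtomisticToContinuum.HydrodynamicLimit.Theorems.RelayRaceLocalityNearConstantShortTimeHLMeansNecessaryFields
import Summits.AtomisticToContinuum.HydrodynamicLimit.Theorems.RelayRaceLocalityNearConstantShortTimeHLMeansNecessaryTools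
import Summits.AtomisticToContinuum.HydrodynamicLimit.Theorems.RelayRaceLocalityNearConstantShortTimeHLOrbitExpansion
import Summits.AtomisticToContinuum.HydrodynamicLimit.Theorems.RelayRaceLocalityNearConstantShortTimeHLFluxIntegrability
import Summits.AtomisticToContinuum.HydrodynamicLimit.Theorems.RelayRaceLocalityNearConstantShortTimeHLDerivContinuity
import Literature.MathematicalPhysics.KineticTheory.HardSphereBBGKYLiouvilleFlow
import HarnessLib

/-!
# Crux `NearConstantShortTimeHL` (stmt-AtomisticToContinuum-12502), line `small-tilt-domination`:
# size, integrability and joint measurability of the log-profile observable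
# (stubs `abs_logProfileObs_le`, `integrable_logProfileObs_flow`, `measurable_logProfileObs_clamp`)

Support file for the crux `…Theses.RelayRaceLocality.NearConstantShortTimeHL`, line `small-tilt-domination`
(route: Yau's relative-entropy method, Grönwall assembly; lead c4), registered stubs

* **`abs_logProfileObs_le`** — along a classical hard-sphere Euler solution with packing `ρσ³ < η₀` on
  `[0, t] × 𝕋³` (analytic equation of state on `[0, η₀)`), the log-profile observable
  `X_r(w) = ρ_w[λ⁰_r] + Σⱼ m_w[λ_{r,·j}]ⱼ + e_w[λ⁴_r]` is affine in the empirical fields with coefficients bounded by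
  one `Λ` on `[0, t] × 𝕋³` (the rows are jointly smooth on a slab `[0, T') ⊇ [0, t]`:
  `exists_horizon_of_packing_lt`, `isSmoothSpaceTimeOn_logProfileRows`, `exists_bounds_moduli_of_isSmoothSpaceTimeOn`),
  whence `|X_r(w)| ≤ C (1 + K(w))`, `K = n⁻¹Σ‖vᵢ‖²/2` (`|ρ_w[χ]| ≤ Λ`, `‖m_w[χ]‖² ≤ Λ² · 2K ≤ (Λ(1/2 + K))²`,
  `|e_w[χ]| ≤ ΛK`);
* **`measurable_logProfileObs_clamp`** — `(r, w) ↦ X_{clamp r}(w)`, `clamp r = max 0 (min r t)`, is jointly Borel on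
  `ℝ × (phase space)`: `ρ, θ, u` are jointly continuous on `[0, t] × 𝕋³` (`continuousOn_derivs_of_isSmoothSpaceTimeOn`)
  and the clamp is continuous into `[0, t]`, so every summand of `X` is continuous in `(r, w)` except the excess
  chemical potential `g_σ(ρ)`, which is MEASURABLE (`f_ex` is a `limsup` of measurable functions and Mathlib's
  everywhere-defined `deriv f_ex` is measurable) — no equation-of-state hypothesis is needed;
* **`integrable_logProfileObs_flow`** — under the canonical local Gibbs law `P` (continuous profiles, `a₀ ≥ 0`,
  `θ₀ > 0`) the kinetic energy per particle has a Gaussian second moment (`lintegral_kineticEnergy_sq_le`), so `K`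
  and `K ∘ Φ_r` (`= K` almost surely: `P ≪ Liouville`, good points are conull, `wc_kineticPP_flow`) are integrable,
  and `X_r ∘ Φ_r` is measurable (previous item, `Φ_r` measurable) and dominated by `C(1 + K ∘ Φ_r)`.

Helpers are prefixed `xt_` (`wg_measurable_V3_apply` is reused from the landed `…FluxIntegrability`); the
measurability of `hsFreeVolume` / `hsExcessFreeEnergy` is copied (with attribution)
from the lead's probe file `SuperlinearityE` of this line.  No definitions, no named facts.

References: H.-T. Yau, Lett. Math. Phys. 22 (1991) §2; H. Spohn, *Large Scale Dynamics of Interacting Particles*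
(1991), Part I §2.3 (Gaussian velocity moments of local Gibbs states).
-/

noncomputable section

namespace Summit.AtomisticToContinuum.HydrodynamicLimit.Theorems.NearConstantShortTimeHL

open scoped BigOperators ENNReal Topology
open MeasureTheory Set Filter
open Literature.MathematicalPhysics.KineticTheory Literature.Analysis.FluidPDE Literature.Analysis.FunctionSpaces

/-! ## Helpers -/

/-- `n⁻¹ Σᵢ ‖vᵢ‖² = 2K(w)`. [folklore] -/
theorem xt_avg_norm_sq_eq {n : ℕ} (w : Config n (Fin 3) T3) :
    (n : ℝ)⁻¹ * ∑ i, ‖(w i).2‖ ^ 2 = 2 * kineticPP w := by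
  unfold kineticPP
  rw [← Finset.sum_div]
  ring

/-- The hard-sphere free volume is measurable in the density parameter (an antitone set function of the exclusion
distance, composed with `η ↦ (η/N)^{1/3}`).  Copied from the lead's probe file `SuperlinearityE` (line
`small-tilt-domination`, c4). [folklore] -/
theorem xt_measurable_hsFreeVolume (N : ℕ) : Measurable fun η : ℝ => hsFreeVolume η N := by
  set Φ : ℝ → ℝ≥0∞ := fun t => volume {q : Fin N → T3 | ∀ i j, i ≠ j → t < Torus.euclidDist (q i) (q j)} with hΦ
  have hanti : Antitone Φ := by
    intro s t hst
    refine measure_mono fun q hq => ?_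
    intro i j hij
    exact lt_of_le_of_lt hst (hq i j hij)
  have hΦm : Measurable Φ := hanti.measurable
  have hr : Measurable fun η : ℝ => (η / N) ^ (1 / 3 : ℝ) := (measurable_id.div_const _).pow_const _
  have : (fun η : ℝ => hsFreeVolume η N) = fun η => (Φ ((η / N) ^ (1 / 3 : ℝ))).toReal := rfl
  rw [this]
  exact (hΦm.comp hr).ennreal_toReal

/-- The hard-sphere excess free energy `f_ex` (a `limsup` of measurable functions) is measurable.  Copied from the
lead's probe file `SuperlinearityE`. [folklore] -/
theorem xt_measurable_hsExcessFreeEnergy : Measurable hsExcessFreeEnergy := by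
  have : hsExcessFreeEnergy = fun η => limsup (fun N : ℕ => -(N : ℝ)⁻¹ * Real.log (hsFreeVolume η N)) atTop := rfl
  rw [this]
  exact Measurable.limsup fun N => measurable_const.mul (xt_measurable_hsFreeVolume N).log

/-- The local excess chemical potential `g_σ(a) = f_ex(aσ³) + aσ³ f_ex′(aσ³)` is measurable (`f_ex` is measurable and
Mathlib's everywhere-defined `deriv f_ex` is measurable, `measurable_deriv`). [folklore] -/
theorem xt_measurable_gChem (σ : ℝ) : Measurable (gChem σ) := by
  have : gChem σ = fun a => hsExcessFreeEnergy (a * σ ^ 3) + a * σ ^ 3 * deriv hsExcessFreeEnergy (a * σ ^ 3) := rfl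
  rw [this]
  exact (xt_measurable_hsExcessFreeEnergy.comp (measurable_id.mul_const _)).add
    ((measurable_id.mul_const _).mul ((measurable_deriv _).comp (measurable_id.mul_const _)))

/-- **Clamped evaluation at a particle position is continuous.** If `f` is jointly continuous on `[0, t] × 𝕋³`
(`0 ≤ t`), then `(r, w) ↦ f (clamp r) (xᵢ(w))`, `clamp r = max 0 (min r t) ∈ [0, t]`, is continuous on
`ℝ × (phase space)`. [folklore] -/
theorem xt_continuous_clamp_particle {F' : Type*} [TopologicalSpace F'] {t : ℝ} (ht : 0 ≤ t) {f : ℝ → T3 → F'}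
    (hf : ContinuousOn (Function.uncurry f) (Set.Icc 0 t ×ˢ Set.univ)) {n : ℕ} (i : Fin n) :
    Continuous fun p : ℝ × Config n (Fin 3) T3 => f (max 0 (min p.1 t)) (p.2 i).1 := by
  have hc : Continuous fun r : ℝ => max 0 (min r t) := continuous_const.max (continuous_id.min continuous_const)
  have hmem : ∀ p : ℝ × Config n (Fin 3) T3,
      (max 0 (min p.1 t), (p.2 i).1) ∈ Set.Icc (0 : ℝ) t ×ˢ (Set.univ : Set T3) := fun p =>
    Set.mk_mem_prod ⟨le_max_left _ _, max_le ht (min_le_right _ _)⟩ (Set.mem_univ _)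
  exact hf.comp_continuous ((hc.comp continuous_fst).prodMk ((continuous_apply i).comp continuous_snd).fst) hmem

/-! ## Registered stub `abs_logProfileObs_le` -/

/-- **Registered stub `abs_logProfileObs_le`: the log-profile observable is dominated by the kinetic energy.**
Along a classical hard-sphere Euler solution with packing `< η₀` on `[0, t] × 𝕋³` (analytic equation of state on
`[0, η₀)`) there is `C > 0` with `|X_r(w)| ≤ C (1 + K(w))` for all `r ∈ [0, t]` and all configurations `w`: the
rows `λ⁰, λ, λ⁴` are bounded by one `Λ` on `[0, t] × 𝕋³` (joint smoothness on a slab `[0, T') ⊇ [0, t]`), and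
`|ρ_w[λ⁰]| ≤ Λ`, `|m_w[λⱼ]ⱼ| ≤ ‖m_w[λⱼ]‖ ≤ Λ(1/2 + K)` (`‖m_w[χ]‖² ≤ Λ² · 2K`), `|e_w[λ⁴]| ≤ ΛK`.
[cite: Yau1991, §2] -/
theorem abs_logProfileObs_le : ∀ {η₀ : ℝ} {F : ℝ → ℝ}, 0 < η₀ → AnalyticOnNhd ℝ F (Set.Ioo (-η₀) η₀) → Set.EqOn hsExcessFreeEnergy F (Set.Ico 0 η₀) → ∀ {σ T : ℝ}, 0 < σ → ∀ {ρ θ : ℝ → T3 → ℝ} {u : ℝ → T3 → V3}, IsHardSphereEulerSolution σ T ρ u θ → ∀ {t : ℝ}, t ∈ Set.Ico 0 T → (∀ s ∈ Set.Icc 0 t, ∀ x, ρ s x * σ ^ 3 < η₀) → ∃ C : ℝ, 0 < C ∧ ∀ r ∈ Set.Icc 0 t, ∀ {n : ℕ} (w : Config n (Fin 3) T3), |logProfileObs σ ρ θ u r w| ≤ C * (1 + kineticPP w) := by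
  intro η₀ F hη₀ hFa hF σ T hσ ρ θ u hE t ht hpack
  -- the rows are jointly smooth on a slab `[0, T') ⊇ [0, t]`, hence bounded on `[0, t] × 𝕋³`
  obtain ⟨T', htT', hT'T, hpack'⟩ := exists_horizon_of_packing_lt hE hσ ht hpack
  obtain ⟨s0, s1, s4⟩ := isSmoothSpaceTimeOn_logProfileRows hη₀ hFa hF hσ hE hT'T hpack'
  have r0 : Torus.IsSmoothSpaceTimeOn (Set.Ico 0 T') (lam0Row σ ρ θ u) := s0
  have r1 : Torus.IsSmoothSpaceTimeOn (Set.Ico 0 T') (lamRow θ u) := s1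
  have r4 : Torus.IsSmoothSpaceTimeOn (Set.Ico 0 T') (lam4Row θ) := s4
  obtain ⟨⟨Λ0, hΛ0, hb0, -⟩, -⟩ := exists_bounds_moduli_of_isSmoothSpaceTimeOn r0 ht.1 htT'
  obtain ⟨⟨Λ1, hΛ1, hb1, -⟩, -⟩ := exists_bounds_moduli_of_isSmoothSpaceTimeOn r1 ht.1 htT'
  obtain ⟨⟨Λ4, hΛ4, hb4, -⟩, -⟩ := exists_bounds_moduli_of_isSmoothSpaceTimeOn r4 ht.1 htT'
  refine ⟨Λ0 + 3 * Λ1 + Λ4, by positivity, fun r hr n w => ?_⟩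
  have hK0 : 0 ≤ kineticPP w := by unfold kineticPP; positivity
  have hvj : ∀ (v : V3) (j : Fin 3), |v j| ≤ ‖v‖ := fun v j => by
    have h := PiLp.norm_apply_le v j
    rwa [Real.norm_eq_abs] at h
  -- the density part
  have hD : |empiricalDensityField w (lam0Row σ ρ θ u r)| ≤ Λ0 :=
    abs_empiricalDensityField_le (fun x => by rw [← Real.norm_eq_abs]; exact (hb0 r hr x).1) hΛ0.le w
  -- the energy part
  have hEn : |empiricalEnergyField w (lam4Row θ r)| ≤ Λ4 * kineticPP w :=
    abs_empiricalEnergyField_le (fun x => by rw [← Real.norm_eq_abs]; exact (hb4 r hr x).1) w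
  -- the momentum part, coordinate by coordinate
  have hM : ∀ j, |(empiricalMomentumField w (fun y => lamRow θ u r y j)) j| ≤ Λ1 * (1 / 2 + kineticPP w) := by
    intro j
    have hχ : ∀ y, |lamRow θ u r y j| ≤ Λ1 := fun y => (hvj _ j).trans (hb1 r hr y).1
    have hsq := norm_empiricalMomentumField_sq_le hχ hΛ1.le w
    rw [xt_avg_norm_sq_eq] at hsq
    have hrhs : 0 ≤ Λ1 * (1 / 2 + kineticPP w) := by positivity
    have hnorm : ‖empiricalMomentumField w (fun y => lamRow θ u r y j)‖ ≤ Λ1 * (1 / 2 + kineticPP w) := by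
      refine (sq_le_sq₀ (norm_nonneg _) hrhs).1 (hsq.trans ?_)
      have h := mul_nonneg (sq_nonneg Λ1) (sq_nonneg (kineticPP w - 1 / 2))
      nlinarith [h]
    exact (hvj _ j).trans hnorm
  have hMs : |∑ j, (empiricalMomentumField w (fun y => lamRow θ u r y j)) j| ≤ 3 * (Λ1 * (1 / 2 + kineticPP w)) :=
    calc |∑ j, (empiricalMomentumField w (fun y => lamRow θ u r y j)) j|
        ≤ ∑ j, |(empiricalMomentumField w (fun y => lamRow θ u r y j)) j| := Finset.abs_sum_le_sum_abs _ _
      _ ≤ ∑ _j : Fin 3, Λ1 * (1 / 2 + kineticPP w) := Finset.sum_le_sum fun j _ => hM j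
      _ = 3 * (Λ1 * (1 / 2 + kineticPP w)) := by simp
  -- assemble
  unfold logProfileObs
  calc |empiricalDensityField w (lam0Row σ ρ θ u r) +
          (∑ j, (empiricalMomentumField w (fun y => lamRow θ u r y j)) j) + empiricalEnergyField w (lam4Row θ r)|
      ≤ |empiricalDensityField w (lam0Row σ ρ θ u r)| +
          |∑ j, (empiricalMomentumField w (fun y => lamRow θ u r y j)) j| + |empiricalEnergyField w (lam4Row θ r)| :=
        abs_add_three _ _ _
    _ ≤ Λ0 + 3 * (Λ1 * (1 / 2 + kineticPP w)) + Λ4 * kineticPP w := add_le_add (add_le_add hD hMs) hEn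
    _ ≤ (Λ0 + 3 * Λ1 + Λ4) * (1 + kineticPP w) := by nlinarith [mul_nonneg hΛ0.le hK0]

/-! ## Registered stub `measurable_logProfileObs_clamp` -/

/-- **Registered stub `measurable_logProfileObs_clamp`: joint measurability of the clamped log-profile observable.**
For a classical solution on `[0, T)` and `t ∈ [0, T)`, `(r, w) ↦ X_{max 0 (min r t)}(w)` is measurable on
`ℝ × (phase space)`: written out (`X = n⁻¹Σᵢ (λ⁰(xᵢ) + λ(xᵢ)·vᵢ + λ⁴(xᵢ)‖vᵢ‖²/2)`), every ingredient is the
continuous `(r, w) ↦ (ρ, θ, u)(clamp r, xᵢ(w))` (joint continuity on `[0, t] × 𝕋³`, continuous clamp) passed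
through `log`, inverses, norms, products and the measurable excess chemical potential `g_σ`. [folklore] -/
theorem measurable_logProfileObs_clamp : ∀ {σ T : ℝ} {ρ θ : ℝ → T3 → ℝ} {u : ℝ → T3 → V3}, IsHardSphereEulerSolution σ T ρ u θ → ∀ {t : ℝ}, t ∈ Set.Ico 0 T → ∀ {n : ℕ}, Measurable (fun p : ℝ × Config n (Fin 3) T3 => logProfileObs σ ρ θ u (max 0 (min p.1 t)) p.2) := by
  intro σ T ρ θ u hE t ht n
  have hρ : ∀ i : Fin n, Measurable fun p : ℝ × Config n (Fin 3) T3 => ρ (max 0 (min p.1 t)) (p.2 i).1 :=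
    fun i => (xt_continuous_clamp_particle ht.1
      (continuousOn_derivs_of_isSmoothSpaceTimeOn hE.smooth_density ht.2).1 i).measurable
  have hθ : ∀ i : Fin n, Measurable fun p : ℝ × Config n (Fin 3) T3 => θ (max 0 (min p.1 t)) (p.2 i).1 :=
    fun i => (xt_continuous_clamp_particle ht.1
      (continuousOn_derivs_of_isSmoothSpaceTimeOn hE.smooth_temperature ht.2).1 i).measurable
  have hu : ∀ i : Fin n, Measurable fun p : ℝ × Config n (Fin 3) T3 => u (max 0 (min p.1 t)) (p.2 i).1 :=
    fun i => (xt_continuous_clamp_particle ht.1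
      (continuousOn_derivs_of_isSmoothSpaceTimeOn hE.smooth_velocity ht.2).1 i).measurable
  have hv : ∀ i : Fin n, Measurable fun p : ℝ × Config n (Fin 3) T3 => (p.2 i).2 :=
    fun i => ((measurable_pi_apply i).comp measurable_snd).snd
  simp only [logProfileObs, empiricalDensityField_eq_sum, empiricalMomentumField_eq_sum, empiricalEnergyField_eq_sum]
  refine ((measurable_const.mul (Finset.measurable_sum _ fun i _ => ?_)).add
    (Finset.measurable_sum _ fun j _ => ?_)).add (measurable_const.mul (Finset.measurable_sum _ fun i _ => ?_))
  · -- the `λ⁰` summand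
    simp only [lam0Row]
    exact ((((hρ i).log.add ((xt_measurable_gChem σ).comp (hρ i))).sub
      (measurable_const.mul ((measurable_const.mul (hθ i)).log))).sub
      (((hu i).norm.pow_const 2).div (measurable_const.mul (hθ i))))
  · -- the momentum summand, coordinate `j`
    have hV : Measurable fun p : ℝ × Config n (Fin 3) T3 =>
        (n : ℝ)⁻¹ • ∑ i, (lamRow θ u (max 0 (min p.1 t)) (p.2 i).1 j) • (p.2 i).2 := by
      refine Measurable.fun_const_smul (Finset.measurable_sum _ fun i _ => ?_) _
      have hL : Measurable fun p : ℝ × Config n (Fin 3) T3 => lamRow θ u (max 0 (min p.1 t)) (p.2 i).1 := by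
        simp only [lamRow]
        exact (hθ i).inv.smul (hu i)
      exact (wg_measurable_V3_apply hL j).smul (hv i)
    exact wg_measurable_V3_apply hV j
  · -- the energy summand
    simp only [lam4Row]
    exact (hθ i).inv.neg.mul (((hv i).norm.pow_const 2).div_const 2)

/-! ## Registered stub `integrable_logProfileObs_flow` -/

/-- **Registered stub `integrable_logProfileObs_flow`: integrability inputs of the expectation-level Grönwall
estimates.** Under the canonical local Gibbs law `P` of a hard-sphere flow `Φ` (continuous profiles, `a₀ ≥ 0`,
`θ₀ > 0`): `K` is integrable (Gaussian second moment, `lintegral_kineticEnergy_sq_le`, on the sub-probability `P`),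
so is `K ∘ Φ_r` for every `r` (`= K` `P`-a.s.: `P ≪ Liouville`, conull good set, energy conservation
`wc_kineticPP_flow`), and for `r ∈ [0, t]` the observable `X_r ∘ Φ_r` is measurable
(`measurable_logProfileObs_clamp` at the slice `r`, `Φ_r` measurable) and dominated by `C (1 + K ∘ Φ_r)`
(`abs_logProfileObs_le`), hence integrable. [cite: Yau1991, §2] -/
theorem integrable_logProfileObs_flow : ∀ {η₀ : ℝ} {F : ℝ → ℝ}, 0 < η₀ → AnalyticOnNhd ℝ F (Set.Ioo (-η₀) η₀) → Set.EqOn hsExcessFreeEnergy F (Set.Ico 0 η₀) → ∀ {σ T : ℝ}, 0 < σ → ∀ {ρ θ : ℝ → T3 → ℝ} {u : ℝ → T3 → V3}, IsHardSphereEulerSolution σ T ρ u θ → ∀ {t : ℝ}, t ∈ Set.Ico 0 T → (∀ s ∈ Set.Icc 0 t, ∀ x, ρ s x * σ ^ 3 < η₀) → ∀ {a₀ θ₀ : T3 → ℝ} {u₀ : T3 → V3}, Continuous a₀ → Continuous θ₀ → Continuous u₀ → (∀ x, 0 ≤ a₀ x) → (∀ x, 0 < θ₀ x) → ∀ {ε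 : ℝ} {n : ℕ} (Φ : HardSphereFlow (Torus.geometry (Fin 3)) ε n), Integrable (fun z => kineticPP z) (particleLaw Φ (canonicalDensity (Torus.geometry (Fin 3)) ε n (localGibbsProfile a₀ u₀ θ₀))) ∧ (∀ r : ℝ, Integrable (fun z => kineticPP (Φ.flow r z)) (particleLaw Φ (canonicalDensity (Torus.geometry (Fin 3)) ε n (localGibbsProfile a₀ u₀ θ₀)))) ∧ (∀ r ∈ Set.Icc 0 t, AEStronglyMeasurable (fun z => logProfileObs σ ρ θ u r (Φ.flow r z)) (particleLaw Φ (canonicalDensity (Torus.geometry (Fin 3)) ε n (localGibbsProfile a₀ u₀ θ₀))) ∧ Integrable (fun z => logProfileObs σ ρ θ u r (Φ.flow r z)) (particleLaw Φ (canonicalDensity (Torus.geometry (Fin 3)) ε n (localGibbsProfile a₀ u₀ θ₀)))) := by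
  intro η₀ F hη₀ hFa hF σ T hσ ρ θ u hE t ht hpack a₀ θ₀ u₀ ha hθc huc ha0 hθ0 ε n Φ
  set P : Measure (Config n (Fin 3) T3) :=
    particleLaw Φ (canonicalDensity (Torus.geometry (Fin 3)) ε n (localGibbsProfile a₀ u₀ θ₀)) with hP
  -- `P` is a sub-probability, absolutely continuous with respect to the Liouville measure
  haveI : IsFiniteMeasure P :=
    ⟨(measure_univ_particleLaw_canonical_le_one Φ ha hθc huc ha0 hθ0).trans_lt ENNReal.one_lt_top⟩
  have hPac : P ≪ liouville (Torus.geometry (Fin 3)) n ε := particleLaw_absolutelyContinuous Φ _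
  have hgood : ∀ᵐ z ∂P, z ∈ Φ.good := hPac.ae_le Φ.ae_mem_good
  -- bounds of the profiles on the compact torus
  obtain ⟨xθ, -, hxθ⟩ := isCompact_univ.exists_isMaxOn Set.univ_nonempty hθc.continuousOn
  obtain ⟨xu, -, hxu⟩ := isCompact_univ.exists_isMaxOn Set.univ_nonempty huc.norm.continuousOn
  have hΘ : ∀ x, θ₀ x ≤ θ₀ xθ := fun x => hxθ (Set.mem_univ x)
  have hU : ∀ x, ‖u₀ x‖ ≤ ‖u₀ xu‖ := fun x => hxu (Set.mem_univ x)
  -- the kinetic energy per particle has a finite second moment, hence is integrable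
  have hKm : Measurable fun z : Config n (Fin 3) T3 => kineticPP z := by
    unfold kineticPP
    exact measurable_const.mul (Finset.measurable_sum _ fun i _ =>
      ((((measurable_pi_apply i).snd).norm.pow_const 2).div_const 2))
  have hK2 : ∫⁻ z, ENNReal.ofReal (kineticPP z ^ 2) ∂P ≤ ENNReal.ofReal (2 * (‖u₀ xu‖ ^ 4 + 15 * θ₀ xθ ^ 2)) :=
    lintegral_kineticEnergy_sq_le Φ ha hθc huc ha0 hθ0 hΘ hU
  have hKi : Integrable (fun z => kineticPP z) P := (integrable_of_lintegral_sq_le hKm hK2).1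
  -- conservation of `K` along the flow, almost surely
  have hKflow : ∀ r : ℝ, Integrable (fun z => kineticPP (Φ.flow r z)) P := fun r => by
    refine hKi.congr ?_
    filter_upwards [hgood] with z hz
    exact (wc_kineticPP_flow Φ hz r).symm
  -- the constant of `abs_logProfileObs_le`
  obtain ⟨C, hC, hCb⟩ := abs_logProfileObs_le hη₀ hFa hF hσ hE ht hpack
  refine ⟨hKi, hKflow, fun r hr => ?_⟩
  -- measurability of the slice `X_r` from the clamped joint measurability
  have hclamp : max 0 (min r t) = r := by rw [min_eq_left hr.2, max_eq_right hr.1]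
  have hXm : Measurable fun w : Config n (Fin 3) T3 => logProfileObs σ ρ θ u r w := by
    have h := (measurable_logProfileObs_clamp (n := n) hE ht).comp
      ((measurable_const (a := r)).prodMk measurable_id)
    simpa only [Function.comp_def, hclamp, id] using h
  have hAE : AEStronglyMeasurable (fun z => logProfileObs σ ρ θ u r (Φ.flow r z)) P :=
    (hXm.comp (Φ.measurable_flow r)).aestronglyMeasurable
  refine ⟨hAE, ?_⟩
  refine (((integrable_const (1 : ℝ)).add (hKflow r)).const_mul C).mono' hAE (Eventually.of_forall fun z => ?_)
  rw [Real.norm_eq_abs]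
  exact hCb r hr (Φ.flow r z)

end Summit.AtomisticToContinuum.HydrodynamicLimit.Theorems.NearConstantShortTimeHL

end
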